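import Summits.CriticalPhenomena.PercolationContinuityZ3.Theorems.PercNearOneGluingNoHeavyLowerTailCILOwnEdgeStability
import HarnessLib

/-!
# `NoHeavyLowerTail` (stmt-CriticalPhenomena-4575) — ABSORPTION MONOTONICITY: gluing a dominated vertex into `x` costs every
# third vertex at most what it costs `x`

Support file (prover `prim-hp-3`, hull-port line, submodularity / Rayleigh-monotonicity seat; `--supports stmt-CriticalPhenomena-4575`).
No definitions, no named facts, no sorries.

Notation: `μ_w = prodBernoulli w` on `Fin n`, relays `A`, level `j`, `π(v) = {z ∈ A : v ↔ z}`, LIGHTNESS `I_w(v) = μ_w{|π(v)| ≤ j}`.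
For a pair `e = s(x,s)` with `w e = 0` write `w¹ = w[e ↦ 1]` (the vertices `x` and `s` GLUED).

**Theorem (`HullPort.lightness_drop_le_of_glue`, absorption monotonicity).**  Let `x ≠ s` with `I_w(s) ≤ I_w(x)` (`x` is at least as
often light as `s`).  Then for EVERY vertex `i`:

      `I_w(i) − I_{w¹}(i) ≤ I_w(x) − I_{w¹}(x)`,

i.e. the lightness that any third vertex loses when `s` is glued into `x` is at most the lightness that `x` itself loses; equivalently the
margin `I(i) − I(x)` can only GROW when `x` absorbs a vertex it dominates (`HullPort.lightness_margin_le_glue`).  The sign version — `I(x) ≤ I(i)`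
survives the gluing — is `CutObserver.lightness_glued_le` and needs no hypothesis on `s`; the quantitative version is FALSE without
`I_w(s) ≤ I_w(x)` (exact census of the seat: 45 / 1 008 violations without it, 0 / 11 376 with it, 0 in 120 adversarial climbs; crux notes
HULLPORT-REF-gen2.md §8).  By affinity in the pair weight the same holds between any two weights `t ≤ t'` of the pair
(`HullPort.lightness_margin_mono`): raising a pair AT the winner of a comparison against a dominated partner never shrinks anybody's margin
over the winner — a Rayleigh-type monotonicity of lightness margins.

Proof.  Pull `w¹` back along `ω ↦ insert e ω` (`ChampionStability.real_update_one_eq`).  A vertex `i` loses lightness only on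
`{i ↔ x} ∪ {i ↔ s}`; on `{i ↔ x}` it loses exactly when `x` does; so the claim is
`μ(i ↔ s, s ↮ x, s light, glued block heavy) ≤ μ(i ↮ x, x light, glued block heavy)`.  Splitting both sides by the lightness of the other
vertex, everything cancels or is dominated termwise except `b₁ = μ(i ↔ s, s light, x heavy)` on the left against `a₁ + a₃ = μ(i ↔ s, x light,
s heavy) + μ(i ↮ x, i ↮ s, x light, s heavy)` on the right, and `b₁ + b₃ ≤ a₁ + a₃` is exactly what the lonely-cluster transfer of
van den Berg–Häggström–Kahn (`Literature.….lonelyClusterTransfer_typeMinus`, pair `(s, x)`, type-`(−)` event `{x ↔ i}`) says after the common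
part `{i ↔ x}` of its two sides is removed.

Use (crux notes §4a, §8): with `x` the port of a pendant star that is most often light and `s` a block of ports it dominates, the theorem is
the quantitative input behind the two-row certificate of `Hyperedge.hyperedgeDD_of_twoRowCertificate` in the single-port case, and it bounds
the witness's loss `δ(T)` in every star pattern `T ∋ x` of the two-sided kernel.
-/

noncomputable section

namespace Summit.CriticalPhenomena.PercolationContinuityZ3.Theorems

open MeasureTheory Set Literature.Probability.LatticeModels Literature.Probability.Percolation
open scoped Classical BigOperators

variable {n : ℕ}

namespace HullPort

open ChampionStability

/-- **Absorption monotonicity.**  Let `x ≠ s`, `e = s(x,s)` with `w e = 0`, and `I_w(s) ≤ I_w(x)`.  Then for every vertex `i`,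
`I_w(i) − I_{w[e↦1]}(i) ≤ I_w(x) − I_{w[e↦1]}(x)`: gluing `s` into `x` costs `i` at most what it costs `x`.
[cite: VandenbergHaggstromKahn2005, Thm. 1.5 (p. 7) — corollary via `lonelyClusterTransfer_typeMinus`, derived in this file] -/
theorem lightness_drop_le_of_glue (w : Sym2 (Fin n) → unitInterval) (A : Finset (Fin n)) (x s i : Fin n) (j : ℕ)
    (hxs : x ≠ s) (hw : w s(x, s) = 0)
    (hle : (prodBernoulli w).real {ω : BondConfig (Fin n) | (A.filter fun z => ω ∈ openConn s z).card ≤ j} ≤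
      (prodBernoulli w).real {ω : BondConfig (Fin n) | (A.filter fun z => ω ∈ openConn x z).card ≤ j}) :
    (prodBernoulli w).real {ω : BondConfig (Fin n) | (A.filter fun z => ω ∈ openConn i z).card ≤ j} -
        (prodBernoulli (Function.update w s(x, s) 1)).real
          {ω : BondConfig (Fin n) | (A.filter fun z => ω ∈ openConn i z).card ≤ j} ≤
      (prodBernoulli w).real {ω : BondConfig (Fin n) | (A.filter fun z => ω ∈ openConn x z).card ≤ j} -
        (prodBernoulli (Function.update w s(x, s) 1)).real
          {ω : BondConfig (Fin n) | (A.filter fun z => ω ∈ openConn x z).card ≤ j} := by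
  set μ := prodBernoulli w with hμ
  -- lightness events before gluing
  set Ri := {ω : BondConfig (Fin n) | (A.filter fun z => ω ∈ openConn i z).card ≤ j} with hRi
  set Rx := {ω : BondConfig (Fin n) | (A.filter fun z => ω ∈ openConn x z).card ≤ j} with hRx
  set Rs := {ω : BondConfig (Fin n) | (A.filter fun z => ω ∈ openConn s z).card ≤ j} with hRs
  -- pulled-back glued lightness events
  set Pi := (fun ω : BondConfig (Fin n) => insert s(x, s) ω) ⁻¹' Ri with hPi
  set Px := (fun ω : BondConfig (Fin n) => insert s(x, s) ω) ⁻¹' Rx with hPx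
  -- connection events
  set D : Set (BondConfig (Fin n)) := (openConn s x : Set (BondConfig (Fin n)))ᶜ with hD
  set B : Set (BondConfig (Fin n)) := (openConn x i : Set (BondConfig (Fin n))) with hB
  set Cs : Set (BondConfig (Fin n)) := (openConn i s : Set (BondConfig (Fin n))) with hCs
  have hmeas : ∀ S : Set (BondConfig (Fin n)), MeasurableSet S := fun S => (Set.toFinite S).measurableSet
  have hfin : ∀ S : Set (BondConfig (Fin n)), μ S ≠ ⊤ := fun S => measure_ne_top _ _
  rw [real_update_one_eq w hw Ri, real_update_one_eq w hw Rx]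
  change μ.real Ri - μ.real Pi ≤ μ.real Rx - μ.real Px
  -- elementary facts about the glued graph
  have hmono : ∀ ω : BondConfig (Fin n), openGraph ω ≤ openGraph (insert s(x, s) ω) := by
    intro ω a b hab
    rw [openGraph_adj] at hab ⊢
    exact ⟨Set.mem_insert_of_mem _ hab.1, hab.2⟩
  have hadj : ∀ ω : BondConfig (Fin n), (openGraph (insert s(x, s) ω)).Reachable x s := by
    intro ω
    have h : (openGraph (insert s(x, s) ω)).Adj x s := by
      rw [openGraph_adj]; exact ⟨Set.mem_insert _ _, hxs⟩
    exact h.reachable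
  -- same cluster ⇒ same lightness membership (old graph)
  have hsame : ∀ (ω : BondConfig (Fin n)) (a b : Fin n), (openGraph ω).Reachable a b →
      ((A.filter fun z => ω ∈ openConn a z).card ≤ j ↔ (A.filter fun z => ω ∈ openConn b z).card ≤ j) := by
    intro ω a b hab
    have heq : (A.filter fun z => ω ∈ openConn a z) = (A.filter fun z => ω ∈ openConn b z) :=
      Finset.filter_congr fun z _ => ⟨fun h => hab.symm.trans h, fun h => hab.trans h⟩
    rw [heq]
  -- same glued cluster ⇒ same glued lightness membership
  have hsame' : ∀ (ω : BondConfig (Fin n)) (a b : Fin n), (openGraph (insert s(x, s) ω)).Reachable a b →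
      ((A.filter fun z => insert s(x, s) ω ∈ openConn a z).card ≤ j ↔
        (A.filter fun z => insert s(x, s) ω ∈ openConn b z).card ≤ j) := by
    intro ω a b hab
    have heq : (A.filter fun z => insert s(x, s) ω ∈ openConn a z) = (A.filter fun z => insert s(x, s) ω ∈ openConn b z) :=
      Finset.filter_congr fun z _ => ⟨fun h => hab.symm.trans h, fun h => hab.trans h⟩
    rw [heq]
  -- (1) gluing only removes lightness: `Px ⊆ Rx`, `Pi ⊆ Ri`
  have hsub : ∀ v : Fin n, (fun ω : BondConfig (Fin n) => insert s(x, s) ω) ⁻¹'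
      {ω : BondConfig (Fin n) | (A.filter fun z => ω ∈ openConn v z).card ≤ j} ⊆
      {ω : BondConfig (Fin n) | (A.filter fun z => ω ∈ openConn v z).card ≤ j} := by
    intro v ω hω
    simp only [mem_preimage, mem_setOf_eq] at hω ⊢
    refine le_trans (Finset.card_le_card fun z hz => ?_) hω
    rw [Finset.mem_filter] at hz ⊢
    exact ⟨hz.1, (hz.2 : (openGraph ω).Reachable v z).mono (hmono ω)⟩
  have hPxRx : Px ⊆ Rx := hsub x
  have hPiRi : Pi ⊆ Ri := hsub i
  -- (2) `s` heavy ⇒ the glued `x` heavy: `Rsᶜ ⊆ Pxᶜ`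
  have hRsPx : ∀ ω : BondConfig (Fin n), ω ∉ Rs → ω ∉ Px := by
    intro ω hω hω'
    apply hω
    simp only [hPx, mem_preimage, hRx, hRs, mem_setOf_eq] at hω' ⊢
    refine le_trans (Finset.card_le_card fun z hz => ?_) hω'
    rw [Finset.mem_filter] at hz ⊢
    exact ⟨hz.1, (hadj ω).trans ((hz.2 : (openGraph ω).Reachable s z).mono (hmono ω))⟩
  -- (3) `x` light and `s` heavy ⇒ `s ↮ x`
  have hRxRsD : ∀ ω : BondConfig (Fin n), ω ∈ Rx → ω ∉ Rs → ω ∈ D := by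
    intro ω hx hs hsx
    exact hs ((hsame ω s x hsx).2 hx)
  have hRsRxD : ∀ ω : BondConfig (Fin n), ω ∈ Rs → ω ∉ Rx → ω ∈ D := by
    intro ω hs hx hsx
    exact hx ((hsame ω s x hsx).1 hs)
  -- the sets of the bookkeeping
  set T : Set (BondConfig (Fin n)) := Cs ∩ D ∩ Rs ∩ Pxᶜ with hT           -- i ↔ s, s ↮ x, s light, glued block heavy
  set A1 : Set (BondConfig (Fin n)) := Cs ∩ Rx ∩ Rsᶜ with hA1              -- i ↔ s, x light, s heavy
  set A3 : Set (BondConfig (Fin n)) := Bᶜ ∩ Csᶜ ∩ Rx ∩ Rsᶜ with hA3        -- i ↮ x, i ↮ s, x light, s heavy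
  set B1 : Set (BondConfig (Fin n)) := Cs ∩ Rs ∩ Rxᶜ with hB1              -- i ↔ s, s light, x heavy
  -- (4) where `i` loses lightness: `Ri \ Pi ⊆ (B ∩ (Rx \ Px)) ∪ T`
  have hloss : Ri \ Pi ⊆ (B ∩ (Rx \ Px)) ∪ T := by
    rintro ω ⟨hRi', hPi'⟩
    by_cases hix : (openGraph ω).Reachable i x
    · left
      refine ⟨(hix.symm : (openGraph ω).Reachable x i), ?_, ?_⟩
      · exact (hsame ω i x hix).1 hRi'
      · intro hPx'
        apply hPi'
        simp only [hPi, hPx, mem_preimage, hRi, hRx, mem_setOf_eq] at hPx' ⊢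
        exact (hsame' ω i x (hix.mono (hmono ω))).2 hPx'
    · by_cases his : (openGraph ω).Reachable i s
      · right
        refine ⟨⟨⟨his, ?_⟩, (hsame ω i s his).1 hRi'⟩, ?_⟩
        · intro hsx
          exact hix (his.trans hsx)
        · intro hPx'
          apply hPi'
          simp only [hPi, hPx, mem_preimage, hRi, hRx, mem_setOf_eq] at hPx' ⊢
          have hix' : (openGraph (insert s(x, s) ω)).Reachable i x := (his.mono (hmono ω)).trans (hadj ω).symm
          exact (hsame' ω i x hix').2 hPx'
      · -- `i` joined to neither end: its cluster is unchanged
        exfalso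
        apply hPi'
        simp only [hPi, mem_preimage, hRi, mem_setOf_eq] at hRi' ⊢
        have heq : (A.filter fun z => insert s(x, s) ω ∈ openConn i z) = (A.filter fun z => ω ∈ openConn i z) :=
          Finset.filter_congr fun z _ => reachable_insert_iff_of_not ω hxs hix his z
        rw [heq]; exact hRi'
  -- (5) `T ⊆ (T ∩ Rx) ∪ B1`, `T ∩ Rx`, `A1`, `A3` pairwise disjoint inside `Bᶜ ∩ (Rx \ Px)`
  have hTsplit : T ⊆ (T ∩ Rx) ∪ B1 := by
    intro ω hω
    by_cases hx : ω ∈ Rx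
    · exact Or.inl ⟨hω, hx⟩
    · exact Or.inr ⟨⟨hω.1.1.1, hω.1.2⟩, hx⟩
  have hTRx : T ∩ Rx ⊆ Bᶜ ∩ (Rx \ Px) := by
    rintro ω ⟨⟨⟨⟨his, hsx⟩, _⟩, hPx'⟩, hx⟩
    refine ⟨?_, hx, hPx'⟩
    intro hxi
    exact hsx ((his : (openGraph ω).Reachable i s).symm.trans (hxi : (openGraph ω).Reachable x i).symm)
  have hA1sub : A1 ⊆ Bᶜ ∩ (Rx \ Px) := by
    rintro ω ⟨⟨his, hx⟩, hs⟩
    refine ⟨?_, hx, hRsPx ω hs⟩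
    intro hxi
    exact (hRxRsD ω hx hs) ((his : (openGraph ω).Reachable i s).symm.trans (hxi : (openGraph ω).Reachable x i).symm)
  have hA3sub : A3 ⊆ Bᶜ ∩ (Rx \ Px) := by
    rintro ω ⟨⟨⟨hB', _⟩, hx⟩, hs⟩
    exact ⟨hB', hx, hRsPx ω hs⟩
  have hdisj1 : Disjoint (T ∩ Rx) A1 := by
    rw [Set.disjoint_left]
    rintro ω ⟨⟨⟨_, hs⟩, _⟩, _⟩ ⟨_, hs'⟩
    exact hs' hs
  have hdisj2 : Disjoint (T ∩ Rx ∪ A1) A3 := by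
    rw [Set.disjoint_left]
    rintro ω hω ⟨⟨⟨_, hCs⟩, _⟩, _⟩
    rcases hω with ⟨⟨⟨⟨his, _⟩, _⟩, _⟩, _⟩ | ⟨⟨his, _⟩, _⟩
    · exact hCs his
    · exact hCs his
  -- (6) the lonely-cluster transfer for the pair `(s, x)` with the type-`(−)` event `B = {x ↔ i}`
  have hX : μ.real (D ∩ (Rx ∩ B)) ≤ μ.real (D ∩ (B ∩ Rs)) + (μ.real Rx - μ.real Rs) :=
    lonelyClusterTransfer_typeMinus w (s := s) (t := x) hxs.symm A j (B := B) (typeMinus_openConn s x i) hle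
  -- rewrite its four terms:  μ(D ∩ (Rx ∩ B)) = e2 + a2,  μ(D ∩ (B ∩ Rs)) = e2 + b2,
  --   μ Rx − μ Rs = (a1 + a2 + a3) − (b1 + b2 + b3)
  set E2 : Set (BondConfig (Fin n)) := D ∩ B ∩ Rx ∩ Rs with hE2
  set A2 : Set (BondConfig (Fin n)) := B ∩ Rx ∩ Rsᶜ with hA2
  set B2 : Set (BondConfig (Fin n)) := B ∩ Rs ∩ Rxᶜ with hB2
  set B3 : Set (BondConfig (Fin n)) := Bᶜ ∩ Csᶜ ∩ Rs ∩ Rxᶜ with hB3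
  have hL : D ∩ (Rx ∩ B) = E2 ∪ A2 := by
    ext ω
    simp only [hE2, hA2, mem_inter_iff, mem_union, mem_compl_iff]
    constructor
    · rintro ⟨hd, hx, hb⟩
      by_cases hs : ω ∈ Rs
      · exact Or.inl ⟨⟨⟨hd, hb⟩, hx⟩, hs⟩
      · exact Or.inr ⟨⟨hb, hx⟩, hs⟩
    · rintro (⟨⟨⟨hd, hb⟩, hx⟩, _⟩ | ⟨⟨hb, hx⟩, hs⟩)
      · exact ⟨hd, hx, hb⟩
      · exact ⟨hRxRsD ω hx hs, hx, hb⟩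
  have hLd : Disjoint E2 A2 := by
    rw [Set.disjoint_left]
    rintro ω ⟨_, hs⟩ ⟨_, hs'⟩
    exact hs' hs
  have hR : D ∩ (B ∩ Rs) = E2 ∪ B2 := by
    ext ω
    simp only [hE2, hB2, mem_inter_iff, mem_union, mem_compl_iff]
    constructor
    · rintro ⟨hd, hb, hs⟩
      by_cases hx : ω ∈ Rx
      · exact Or.inl ⟨⟨⟨hd, hb⟩, hx⟩, hs⟩
      · exact Or.inr ⟨⟨hb, hs⟩, hx⟩
    · rintro (⟨⟨⟨hd, hb⟩, hx⟩, hs⟩ | ⟨⟨hb, hs⟩, hx⟩)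
      · exact ⟨hd, hb, hs⟩
      · exact ⟨hRsRxD ω hs hx, hb, hs⟩
  have hRd : Disjoint E2 B2 := by
    rw [Set.disjoint_left]
    rintro ω ⟨⟨_, hx⟩, _⟩ ⟨_, hx'⟩
    exact hx' hx
  -- μ Rx − μ Rs = μ (Rx \ Rs) − μ (Rs \ Rx)
  have hdiff : μ.real Rx - μ.real Rs = μ.real (Rx \ Rs) - μ.real (Rs \ Rx) := by
    have h1 : μ.real Rx = μ.real (Rx ∩ Rs) + μ.real (Rx \ Rs) :=
      (measureReal_inter_add_sdiff (μ := μ) (s := Rx) (hmeas Rs)).symm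
    have h2 : μ.real Rs = μ.real (Rs ∩ Rx) + μ.real (Rs \ Rx) :=
      (measureReal_inter_add_sdiff (μ := μ) (s := Rs) (hmeas Rx)).symm
    rw [h1, h2, inter_comm Rs Rx]; ring
  -- Rx \ Rs = A2 ∪ (A1 ∪ A3),  Rs \ Rx = B2 ∪ (B1 ∪ B3)
  have hRxRs : Rx \ Rs = A2 ∪ (A1 ∪ A3) := by
    ext ω
    simp only [hA2, hA1, hA3, mem_sdiff, mem_union, mem_inter_iff, mem_compl_iff]
    constructor
    · rintro ⟨hx, hs⟩
      by_cases hb : ω ∈ B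
      · exact Or.inl ⟨⟨hb, hx⟩, hs⟩
      · by_cases hc : ω ∈ Cs
        · exact Or.inr (Or.inl ⟨⟨hc, hx⟩, hs⟩)
        · exact Or.inr (Or.inr ⟨⟨⟨hb, hc⟩, hx⟩, hs⟩)
    · rintro (⟨⟨_, hx⟩, hs⟩ | ⟨⟨_, hx⟩, hs⟩ | ⟨⟨⟨_, _⟩, hx⟩, hs⟩) <;> exact ⟨hx, hs⟩
  have hRsRx : Rs \ Rx = B2 ∪ (B1 ∪ B3) := by
    ext ω
    simp only [hB2, hB1, hB3, mem_sdiff, mem_union, mem_inter_iff, mem_compl_iff]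
    constructor
    · rintro ⟨hs, hx⟩
      by_cases hb : ω ∈ B
      · exact Or.inl ⟨⟨hb, hs⟩, hx⟩
      · by_cases hc : ω ∈ Cs
        · exact Or.inr (Or.inl ⟨⟨hc, hs⟩, hx⟩)
        · exact Or.inr (Or.inr ⟨⟨⟨hb, hc⟩, hs⟩, hx⟩)
    · rintro (⟨⟨_, hs⟩, hx⟩ | ⟨⟨_, hs⟩, hx⟩ | ⟨⟨⟨_, _⟩, hs⟩, hx⟩) <;> exact ⟨hs, hx⟩
  -- on `Rx ∩ Rsᶜ` (and `Rs ∩ Rxᶜ`) the vertex `i` cannot be joined to both `x` and `s`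
  have hBCs : ∀ ω : BondConfig (Fin n), ω ∈ B → ω ∈ Cs → (ω ∈ Rx ↔ ω ∈ Rs) := by
    intro ω hb hc
    have hsx : (openGraph ω).Reachable s x := (hc : (openGraph ω).Reachable i s).symm.trans (hb : (openGraph ω).Reachable x i).symm
    exact (hsame ω s x hsx).symm
  have hdA : Disjoint A2 (A1 ∪ A3) := by
    rw [Set.disjoint_left]
    rintro ω ⟨⟨hb, hx⟩, hs⟩ (⟨⟨hc, _⟩, _⟩ | ⟨⟨⟨hb', _⟩, _⟩, _⟩)
    · exact hs ((hBCs ω hb hc).1 hx)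
    · exact hb' hb
  have hdA' : Disjoint A1 A3 := by
    rw [Set.disjoint_left]
    rintro ω ⟨⟨hc, _⟩, _⟩ ⟨⟨⟨_, hc'⟩, _⟩, _⟩
    exact hc' hc
  have hdB : Disjoint B2 (B1 ∪ B3) := by
    rw [Set.disjoint_left]
    rintro ω ⟨⟨hb, hs⟩, hx⟩ (⟨⟨hc, _⟩, _⟩ | ⟨⟨⟨hb', _⟩, _⟩, _⟩)
    · exact hx ((hBCs ω hb hc).2 hs)
    · exact hb' hb
  have hdB' : Disjoint B1 B3 := by
    rw [Set.disjoint_left]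
    rintro ω ⟨⟨hc, _⟩, _⟩ ⟨⟨⟨_, hc'⟩, _⟩, _⟩
    exact hc' hc
  -- the key consequence of the exchange:  μ B1 + μ B3 ≤ μ A1 + μ A3
  have hkey : μ.real B1 + μ.real B3 ≤ μ.real A1 + μ.real A3 := by
    have e1 : μ.real (D ∩ (Rx ∩ B)) = μ.real E2 + μ.real A2 := by rw [hL, measureReal_union hLd (hmeas A2)]
    have e2 : μ.real (D ∩ (B ∩ Rs)) = μ.real E2 + μ.real B2 := by rw [hR, measureReal_union hRd (hmeas B2)]
    have e3 : μ.real (Rx \ Rs) = μ.real A2 + (μ.real A1 + μ.real A3) := by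
      rw [hRxRs, measureReal_union hdA ((hmeas A1).union (hmeas A3)), measureReal_union hdA' (hmeas A3)]
    have e4 : μ.real (Rs \ Rx) = μ.real B2 + (μ.real B1 + μ.real B3) := by
      rw [hRsRx, measureReal_union hdB ((hmeas B1).union (hmeas B3)), measureReal_union hdB' (hmeas B3)]
    have h := hX
    rw [e1, e2, hdiff, e3, e4] at h
    linarith
  -- (7) assemble
  have hdrop_i : μ.real Ri - μ.real Pi = μ.real (Ri \ Pi) := by
    have h := measureReal_inter_add_sdiff (μ := μ) (s := Ri) (hmeas Pi)
    rw [inter_eq_right.2 hPiRi] at h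
    linarith
  have hdrop_x : μ.real Rx - μ.real Px = μ.real (Rx \ Px) := by
    have h := measureReal_inter_add_sdiff (μ := μ) (s := Rx) (hmeas Px)
    rw [inter_eq_right.2 hPxRx] at h
    linarith
  have hsplit_x : μ.real (Rx \ Px) = μ.real (B ∩ (Rx \ Px)) + μ.real (Bᶜ ∩ (Rx \ Px)) := by
    have h := measureReal_inter_add_sdiff (μ := μ) (s := Rx \ Px) (hmeas B)
    rw [inter_comm (Rx \ Px) B, show (Rx \ Px) \ B = Bᶜ ∩ (Rx \ Px) from sdiff_eq_compl_inter] at h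
    linarith
  calc μ.real Ri - μ.real Pi = μ.real (Ri \ Pi) := hdrop_i
    _ ≤ μ.real ((B ∩ (Rx \ Px)) ∪ T) := measureReal_mono hloss (hfin _)
    _ ≤ μ.real (B ∩ (Rx \ Px)) + μ.real T := measureReal_union_le _ _
    _ ≤ μ.real (B ∩ (Rx \ Px)) + (μ.real (T ∩ Rx) + μ.real B1) := by
        have h1 : μ.real T ≤ μ.real ((T ∩ Rx) ∪ B1) := measureReal_mono hTsplit (hfin _)
        have h2 : μ.real ((T ∩ Rx) ∪ B1) ≤ μ.real (T ∩ Rx) + μ.real B1 := measureReal_union_le _ _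
        linarith
    _ ≤ μ.real (B ∩ (Rx \ Px)) + (μ.real (T ∩ Rx) + μ.real A1 + μ.real A3) := by
        linarith [hkey, measureReal_nonneg (μ := μ) (s := B3)]
    _ = μ.real (B ∩ (Rx \ Px)) + μ.real ((T ∩ Rx ∪ A1) ∪ A3) := by
        rw [measureReal_union hdisj2 (hmeas A3), measureReal_union hdisj1 (hmeas A1)]
    _ ≤ μ.real (B ∩ (Rx \ Px)) + μ.real (Bᶜ ∩ (Rx \ Px)) := by
        have hsub3 : (T ∩ Rx ∪ A1) ∪ A3 ⊆ Bᶜ ∩ (Rx \ Px) :=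
          union_subset (union_subset hTRx hA1sub) hA3sub
        linarith [measureReal_mono hsub3 (hfin (Bᶜ ∩ (Rx \ Px)))]
    _ = μ.real (Rx \ Px) := hsplit_x.symm
    _ = μ.real Rx - μ.real Px := hdrop_x.symm

/-- **Margin form.**  With `x ≠ s`, `w s(x,s) = 0` and `I_w(s) ≤ I_w(x)`: for every vertex `i`,
`I_w(i) − I_w(x) ≤ I_{w[s(x,s)↦1]}(i) − I_{w[s(x,s)↦1]}(x)` — the margin of `i` over `x` does not shrink when `x` absorbs `s`.
[this file] -/
theorem lightness_margin_le_glue (w : Sym2 (Fin n) → unitInterval) (A : Finset (Fin n)) (x s i : Fin n) (j : ℕ)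
    (hxs : x ≠ s) (hw : w s(x, s) = 0)
    (hle : (prodBernoulli w).real {ω : BondConfig (Fin n) | (A.filter fun z => ω ∈ openConn s z).card ≤ j} ≤
      (prodBernoulli w).real {ω : BondConfig (Fin n) | (A.filter fun z => ω ∈ openConn x z).card ≤ j}) :
    (prodBernoulli w).real {ω : BondConfig (Fin n) | (A.filter fun z => ω ∈ openConn i z).card ≤ j} -
        (prodBernoulli w).real {ω : BondConfig (Fin n) | (A.filter fun z => ω ∈ openConn x z).card ≤ j} ≤
      (prodBernoulli (Function.update w s(x, s) 1)).real
          {ω : BondConfig (Fin n) | (A.filter fun z => ω ∈ openConn i z).card ≤ j} -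
        (prodBernoulli (Function.update w s(x, s) 1)).real
          {ω : BondConfig (Fin n) | (A.filter fun z => ω ∈ openConn x z).card ≤ j} := by
  have h := lightness_drop_le_of_glue w A x s i j hxs hw hle
  linarith

/-- **Margin monotonicity in the pair weight.**  Let `x ≠ s`, `e = s(x,s)`, `w₀ = w[e ↦ 0]`, and `I_{w₀}(s) ≤ I_{w₀}(x)`.  Then the margin
of any vertex `i` over `x` is at least as large under `w` as under `w₀`:
`I_{w₀}(i) − I_{w₀}(x) ≤ I_w(i) − I_w(x)` (one-bond decomposition: `I_w = (1 − w e)·I_{w₀} + (w e)·I_{w₀[e↦1]}`, and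
`HullPort.lightness_margin_le_glue` at `w₀`).  Raising a pair at the winner of a comparison against a dominated partner never shrinks a
third party's margin over the winner. [this file] -/
theorem lightness_margin_mono (w : Sym2 (Fin n) → unitInterval) (A : Finset (Fin n)) (x s i : Fin n) (j : ℕ)
    (hxs : x ≠ s)
    (hle : (prodBernoulli (Function.update w s(x, s) 0)).real
          {ω : BondConfig (Fin n) | (A.filter fun z => ω ∈ openConn s z).card ≤ j} ≤
        (prodBernoulli (Function.update w s(x, s) 0)).real
          {ω : BondConfig (Fin n) | (A.filter fun z => ω ∈ openConn x z).card ≤ j}) :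
    (prodBernoulli (Function.update w s(x, s) 0)).real
          {ω : BondConfig (Fin n) | (A.filter fun z => ω ∈ openConn i z).card ≤ j} -
        (prodBernoulli (Function.update w s(x, s) 0)).real
          {ω : BondConfig (Fin n) | (A.filter fun z => ω ∈ openConn x z).card ≤ j} ≤
      (prodBernoulli w).real {ω : BondConfig (Fin n) | (A.filter fun z => ω ∈ openConn i z).card ≤ j} -
        (prodBernoulli w).real {ω : BondConfig (Fin n) | (A.filter fun z => ω ∈ openConn x z).card ≤ j} := by
  set e : Sym2 (Fin n) := s(x, s) with he
  set w₀ := Function.update w e 0 with hw₀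
  set Ri := {ω : BondConfig (Fin n) | (A.filter fun z => ω ∈ openConn i z).card ≤ j} with hRi
  set Rx := {ω : BondConfig (Fin n) | (A.filter fun z => ω ∈ openConn x z).card ≤ j} with hRx
  have hw₀e : w₀ s(x, s) = 0 := by simp [hw₀, he]
  have hw₁ : Function.update w e 1 = Function.update w₀ s(x, s) 1 := by
    rw [hw₀, he, Function.update_idem]
  have hglue := lightness_margin_le_glue w₀ A x s i j hxs hw₀e hle
  have hp0 : 0 ≤ (w e : ℝ) := (w e).2.1
  rw [stub_oneBondDecomp_k15 n w e Ri, stub_oneBondDecomp_k15 n w e Rx, hw₁]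
  have hb : (w e : ℝ) * ((prodBernoulli w₀).real Ri - (prodBernoulli w₀).real Rx) ≤
      (w e : ℝ) * ((prodBernoulli (Function.update w₀ s(x, s) 1)).real Ri -
        (prodBernoulli (Function.update w₀ s(x, s) 1)).real Rx) :=
    mul_le_mul_of_nonneg_left hglue hp0
  linarith [hb]

end HullPort

end Summit.CriticalPhenomena.PercolationContinuityZ3.Theorems

end
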